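import Mathlib
import HarnessLib
import Literature.Combinatorics.Additive.UniformCoverInequality
import Literature.Combinatorics.Optimization.FarkasLemma

/-!
# The Bollobás–Thomason Box Theorem for finite point sets and for sumsets
# (Bollobás–Thomason 1995, Theorem 1; Balister–Bollobás 2012, eq. (2), Theorem 8 and
# Corollary 11)

Topic `Literature/Combinatorics/Additive`.  Cell `mm-stpp` (D-0046), seat `mm-stpp-lit` (gen 12);
companion of `UniformCoverInequality.lean` (the Uniform Cover Inequality (UC-latt), its fractional
form, and Balister–Bollobás 2012 Theorems 8 (second half), 10 and 13), whose module docstring listed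
the present results under "NOT FORMALIZED: the Box Theorem … and its additive analogue BB Cor 11".
Everything in this file is PROVED (no named facts).

**Theorem (Bollobás–Thomason 1995, Theorem 1 — the Box Theorem).**  "Let `K` be a body in `ℝⁿ`.
Then there is a box `B` in `ℝⁿ` with `|B| = |K|` and `|B_A| ≤ |K_A|` for every `A ⊆ [n]`."
Balister–Bollobás 2012, §2: "This theorem is equivalent to the assertion that there exist constants
`k_i ≥ 0` such that `|K| = ∏_{i=1}^n k_i` and `|K_A| ≥ ∏_{i∈A} k_i` for all `A ⊆ [n]`" (their
eq. (2)), and "by identifying a lattice point `z ∈ ℤⁿ` with the unit cube `Q_z ⊆ ℝⁿ` with centre `z`"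
a statement about bodies becomes one about finite sets `S ⊆ ℤⁿ` and their coordinate projections
`S_A` (their (UC-latt)).  HERE: the lattice/point-set case of Theorem 1 in the form (2) —
`UniformCover.exists_box_of_nonempty`: for every non-empty finite `S ⊆ Xⁿ` (one coordinate type
`X`, points `Fin n → X`, projections `UniformCover.proj` as in `UniformCoverInequality.lean`) there
are reals `λ₁, …, λ_n > 0` with `∏ᵢ λᵢ = |S|` and `∏_{i∈A} λᵢ ≤ |S_A|` for every `A ⊆ [n]`.  The
trivial converse direction ("Clearly, if `B` is a box and `𝒞` is a `k`-cover of `[n]`, then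
`∏_{A∈𝒞} |B_A| = |B|ᵏ`.  In view of this … Theorem 2 can be considered as a special case of
Theorem 1", BT p. 418) is `UniformCover.prod_prod_eq_prod_pow_of_isUniformCover` /
`UniformCover.pow_card_le_prod_card_image_proj_of_box` (Bollobás–Thomason's "`k`-cover" is "each
element of `[n]` is in exactly `k` of the members", i.e. `UniformCover.IsUniformCover k`).

**Theorem (Balister–Bollobás 2012, Theorem 8, first half — the Box Theorem for sumsets).**  "Let
`S₁, …, S_n` be finite sets in a commutative semigroup with sum `S = S₁ + ⋯ + S_n`.  For `A ⊆ [n]`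
set `S_A = ∑_{i∈A} S_i` … There are constants `λ₁, …, λ_n ≥ 0` such that `|S| = ∏₁ⁿ λᵢ` and
`|S_A| ≥ ∏_{i∈A} λᵢ` for all `A ⊆ [n]`." — `exists_box_card_subsum` (arbitrary finite `S_i` in an
additive commutative monoid; `λ ≡ 0` when some `S_i = ∅`) and `exists_pos_box_card_subsum`
(`λᵢ > 0` when every `S_i ≠ ∅`), "immediate from (UC-latt) applied to `S′`" — here from the
point-set Box Theorem through the representation lemma `exists_repr_card_image_proj_le` of
`UniformCoverInequality.lean` (GMR's lexicographically least representations, "`|(S′)_A| ≤ |S_A|`").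
The second half of Theorem 8 (the uniform cover inequality for sumsets) is
`pow_card_sum_le_prod_card_subsum` there.

**Corollary (Balister–Bollobás 2012, Corollary 11 — the additive box).**  "If the sets `S_i` lie in
a torsion-free abelian group then there exists constants `σᵢ` such that `|S| − 1 = ∑_{i=1}^n σᵢ` and
`|S_A| − 1 ≤ ∑_{i∈A} σᵢ` for all `A ⊆ [n]`." — `exists_additive_box_card_subsum` (rational `σᵢ`,
non-empty `S_i`; real form `exists_additive_box_card_subsum_real`; with `σᵢ ≥ |S_i| − 1 ≥ 0` recorded,
`exists_additive_box_card_subsum_nonneg`).  The converse bookkeeping — an additive box gives back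
the first inequality of BB Theorem 10 for every uniform `k`-cover — is
`UniformCover.sum_sum_eq_smul_sum_of_isUniformCover` / `sum_card_subsum_le_of_additive_box`.

## Proofs (where they deviate from print)

Bollobás–Thomason prove Theorem 1 from the Uniform Cover Inequality (their Theorem 2) by a
minimality argument over the finitely many irreducible uniform covers (p. 419); Balister–Bollobás
only recall that "the Box Theorem was deduced from the Uniform Cover Inequality".  Here the
deduction is by LINEAR-PROGRAMMING DUALITY, because the tree supplies Farkas' lemma
(`Literature.Combinatorics.Optimization.farkas_eq`, Schrijver 1986 Cor. 7.1e with equality rows, over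
any linear ordered field): in the unknowns `x_i = log λᵢ` the box conditions are the linear system
`∑_{i∈A} x_i ≤ log |S_A|` (`A ⊆ [n]`), `∑_i x_i = log |S|`; a Farkas certificate of infeasibility
`y_A ≥ 0`, `z` has `∑_{A∋i} y_A = −z =: μ` for every `i` and `∑_A y_A log |S_A| < μ log |S|`; for
`μ ≤ 0` this is absurd since every `|S_A| ≥ 1` and `|S| ≥ 1`, and for `μ > 0` the weights `y_A / μ`
are a fractional uniform cover, so the fractional cover inequality
`UniformCover.card_le_prod_card_image_proj_rpow` (Madiman–Marcus–Tetali 2012 Cor 3, in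
`UniformCoverInequality.lean`; Bollobás–Thomason p. 419 "`|K| ≤ ∏_{A∈𝒞} |K_A|^{w(A)}`") gives
`log |S| ≤ ∑_A (y_A/μ) log |S_A|`, the opposite inequality.  (No case distinction on `n` is needed.)
Corollary 11, for which no proof is printed, is obtained the same way with EXACT data: Farkas'
lemma over `ℚ` for `−∑_{i∈A} σ_i ≤ 1 − |S_A|`, `∑_i σ_i = |S| − 1`; a rational certificate
`y_A ≥ 0` is cleared of denominators (`D y_A = m_A ∈ ℕ`, `D μ = k ∈ ℕ`), the multiset with `m_A`
copies of `A` is an honest uniform `k`-cover (as the indexed family on `Σ A, Fin m_A`), and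
Balister–Bollobás' Theorem 10 (`exists_pair_subsets_sum_card_subsum_le`, torsion-free form) gives
`∑_A m_A (|S_A| − 1) ≤ k (|S| − 1)`, i.e. `∑_A y_A (|S_A| − 1) ≤ μ (|S| − 1)`, against the strict
certificate inequality (for `n = 0` both sides vanish).

NOT FORMALIZED: Theorem 1 for bodies / product measures in `ℝⁿ` (the tree's uniform cover
inequality is the discrete one; `-- TODO(general form)` below), BT Theorems 3–4 (monotone
functionals; the equality cases of the uniform cover inequality), BB Theorem 7 (sections) and the
entropy Box Theorem BB Theorem 4.  Census-silent for the cell `mm-stpp`.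

## References
* B. Bollobás, A. Thomason, *Projections of bodies and hereditary properties of hypergraphs*,
  Bull. London Math. Soc. 27 (1995) 417–424, Theorem 1 (p. 417), Theorem 2 and the remark before it
  (p. 418), proof of Theorem 1 and the weighted-cover remark (p. 419) — held
  `paper:doi-10-1112-blms-27-5-417`, pp. 1–4 read 2026-08-28 [cite: BollobasThomason1995, Thm 1].
* P. Balister, B. Bollobás, *Projections, entropy and sumsets*, Combinatorica 32 (2012) 125–141,
  §2 (Theorem 1 = the Box Theorem, eq. (2), (UC), (UC-latt)), §5 Theorem 8, Theorem 10,
  Corollary 11 — held `paper:arxiv-0711.1151`, chunks p0004, p0007–p0008 read 2026-08-28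
  [cite: BalisterBollobas2012, eq. (2); Thm 8; Cor 11].
* A. Schrijver, *Theory of Linear and Integer Programming* (1986), Cor. 7.1e — through
  `Literature.Combinatorics.Optimization.farkas_eq`.
* M. Madiman, A. W. Marcus, P. Tetali, *Entropy and set cardinality inequalities for
  partition-determined functions*, Random Struct. Alg. 40 (2012), Cor 3 — through
  `UniformCover.card_le_prod_card_image_proj_rpow`.
-/

-- TODO(general form): Bollobás–Thomason 1995 Theorem 1 for bodies `K ⊆ ℝⁿ` (Lebesgue / product
-- measures) needs the uniform cover inequality for measurable sets; the tree has the discrete one.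

namespace Literature.Combinatorics.Additive

open Finset

namespace UniformCover

variable {X : Type*}

/-- **A box satisfies every uniform cover inequality with equality** (Bollobás–Thomason 1995,
before Theorem 2: "Clearly, if `B` is a box and `𝒞` is a `k`-cover of `[n]`, then
`∏_{A∈𝒞} |B_A| = |B|ᵏ`"; BT's "`k`-cover" means "each element of `[n]` is in exactly `k` of the
members", i.e. `IsUniformCover k`): for side lengths `λ : [n] → M` in any commutative monoid and a uniform
`k`-cover `𝒜`, `∏_{a} ∏_{i∈𝒜 a} λᵢ = (∏ᵢ λᵢ)ᵏ`. [cite: BollobasThomason1995, §1 (before Thm 2)] -/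
theorem prod_prod_eq_prod_pow_of_isUniformCover {M : Type*} [CommMonoid M] {ι : Type*} [Fintype ι]
    {n k : ℕ} (𝒜 : ι → Finset (Fin n)) (h𝒜 : IsUniformCover k 𝒜) (lam : Fin n → M) :
    ∏ a, ∏ i ∈ 𝒜 a, lam i = (∏ i, lam i) ^ k := by
  classical
  rw [← prod_pow]
  calc ∏ a, ∏ i ∈ 𝒜 a, lam i = ∏ a, ∏ i, (if i ∈ 𝒜 a then lam i else 1) := by
        refine prod_congr rfl fun a _ => ?_
        rw [prod_ite_mem, univ_inter]
    _ = ∏ i, ∏ a, (if i ∈ 𝒜 a then lam i else 1) := prod_comm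
    _ = ∏ i, lam i ^ k := by
        refine prod_congr rfl fun i _ => ?_
        rw [prod_ite, prod_const_one, mul_one, prod_const]
        simp only [IsUniformCover] at h𝒜
        rw [h𝒜 i]

/-- **The Bollobás–Thomason Box Theorem, lattice/point-set case** (Bollobás–Thomason 1995,
Theorem 1: "Let `K` be a body in `ℝⁿ`.  Then there is a box `B` in `ℝⁿ` with `|B| = |K|` and
`|B_A| ≤ |K_A|` for every `A ⊆ [n]`", in the equivalent form of Balister–Bollobás 2012 eq. (2):
"there exist constants `k_i ≥ 0` such that `|K| = ∏ k_i` and `|K_A| ≥ ∏_{i∈A} k_i` for all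
`A ⊆ [n]`", read for finite point sets through BB's unit-cube identification of §2).  For every
non-empty finite `S ⊆ Xⁿ` there are reals `λ₁, …, λ_n > 0` with `∏ᵢ λᵢ = |S|` and
`∏_{i∈A} λᵢ ≤ |S_A|` for every `A ⊆ [n]` (`S_A = S.image (proj A)`).  Proof by LP duality (not the
printed minimality argument): Farkas' lemma `Literature.Combinatorics.Optimization.farkas_eq` over
`ℝ` for the system `∑_{i∈A} x_i ≤ log |S_A|`, `∑_i x_i = log |S|` in `x_i = log λᵢ`; a certificate of
infeasibility is, after normalisation, a fractional uniform cover violating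
`card_le_prod_card_image_proj_rpow`. [cite: BollobasThomason1995, Thm 1]
[cite: BalisterBollobas2012, §2 eq. (2)] -/
theorem exists_box_of_nonempty [DecidableEq X] {n : ℕ} (B : Finset (Fin n → X))
    (hB : B.Nonempty) :
    ∃ lam : Fin n → ℝ, (∀ i, 0 < lam i) ∧ ∏ i, lam i = #B ∧
      ∀ A : Finset (Fin n), ∏ i ∈ A, lam i ≤ #(B.image (proj A)) := by
  classical
  -- the data of the linear program: `N_A = |B_A| ≥ 1`, `|B| ≥ 1`
  set N : Finset (Fin n) → ℝ := fun A => (#(B.image (proj A)) : ℝ) with hN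
  have hN1 : ∀ A, 1 ≤ N A := fun A => by
    simp only [hN]
    exact_mod_cast card_pos.2 (hB.image _)
  have hN0 : ∀ A, 0 < N A := fun A => one_pos.trans_le (hN1 A)
  have hB1 : (1 : ℝ) ≤ #B := by exact_mod_cast hB.card_pos
  have hB0 : (0 : ℝ) < #B := one_pos.trans_le hB1
  -- Farkas' lemma for the system `∑_{j∈A} x_j ≤ log N_A (A ⊆ [n])`, `∑_j x_j = log |B|`
  rcases Literature.Combinatorics.Optimization.farkas_eq (𝕜 := ℝ) (p := Unit)
      (fun (A : Finset (Fin n)) (j : Fin n) => if j ∈ A then (1 : ℝ) else 0)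
      (fun A => Real.log (N A)) (fun _ _ => (1 : ℝ)) (fun _ => Real.log #B) with
    ⟨x, hxle, hxeq⟩ | ⟨y, z, hy, hyA, hyb⟩
  · -- a feasible point gives the box `λ_j = exp x_j`
    refine ⟨fun j => Real.exp (x j), fun j => Real.exp_pos _, ?_, fun A => ?_⟩
    · rw [← Real.exp_sum, ← Real.exp_log hB0]
      congr 1
      simpa using hxeq ()
    · rw [← Real.exp_sum]
      calc Real.exp (∑ i ∈ A, x i) ≤ Real.exp (Real.log (N A)) := by
            refine Real.exp_le_exp.2 ?_
            have := hxle A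
            simpa [Finset.sum_ite_mem, univ_inter] using this
        _ = N A := Real.exp_log (hN0 A)
  · -- the Farkas alternative contradicts the fractional uniform cover inequality
    exfalso
    set μ : ℝ := -z () with hμ
    have hz : z () = -μ := by rw [hμ, neg_neg]
    -- `∑_{A ∋ j} y_A = μ` for every coordinate `j`
    have hcov : ∀ j : Fin n, ∑ A ∈ univ.filter (fun A => j ∈ A), y A = μ := by
      intro j
      have h := hyA j
      simp only [mul_ite, mul_one, mul_zero, Fintype.sum_unique] at h
      rw [← sum_filter] at h
      change ∑ A ∈ univ.filter (fun A => j ∈ A), y A + z () = 0 at h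
      linarith
    -- the certificate inequality: `∑_A y_A log N_A - μ log |B| < 0`
    have hlt : ∑ A, y A * Real.log (N A) - μ * Real.log #B < 0 := by
      have h := hyb
      simp only [Fintype.sum_unique] at h
      rw [hz] at h
      linarith
    rcases le_or_gt μ 0 with hμ0 | hμ0
    · -- `μ ≤ 0`: every term is non-negative
      have h1 : 0 ≤ ∑ A, y A * Real.log (N A) :=
        sum_nonneg fun A _ => mul_nonneg (hy A) (Real.log_nonneg (hN1 A))
      have h2 : μ * Real.log #B ≤ 0 :=
        mul_nonpos_of_nonpos_of_nonneg hμ0 (Real.log_nonneg hB1)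
      linarith
    · -- `μ > 0`: `w_A = y_A / μ` is a fractional cover; apply the fractional cover inequality
      have hw0 : ∀ A, 0 ≤ y A / μ := fun A => div_nonneg (hy A) hμ0.le
      have hwcov : ∀ j : Fin n, 1 ≤ ∑ A ∈ univ.filter (fun A => j ∈ (fun A => A) A), y A / μ := by
        intro j
        rw [← sum_div, hcov j, div_self hμ0.ne']
      have hfrac := card_le_prod_card_image_proj_rpow (fun A : Finset (Fin n) => A)
        (fun A => y A / μ) hw0 hwcov B
      -- take logarithms
      have hlog : Real.log #B ≤ ∑ A, (y A / μ) * Real.log (N A) := by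
        have := Real.log_le_log hB0 hfrac
        rw [Real.log_prod (s := univ) (fun A _ => (Real.rpow_pos_of_pos (hN0 A) _).ne')] at this
        refine this.trans (le_of_eq (sum_congr rfl fun A _ => ?_))
        rw [Real.log_rpow (hN0 A)]
      have hmul : μ * Real.log #B ≤ ∑ A, y A * Real.log (N A) := by
        calc μ * Real.log #B ≤ μ * ∑ A, (y A / μ) * Real.log (N A) :=
              mul_le_mul_of_nonneg_left hlog hμ0.le
          _ = ∑ A, y A * Real.log (N A) := by
              rw [mul_sum]
              refine sum_congr rfl fun A _ => ?_
              field_simp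
      linarith

/-- **Theorem 2 is a special case of Theorem 1** (Bollobás–Thomason 1995, p. 418: "if `B` is a
box and `𝒞` is a `k`-cover of `[n]`, then `∏_{A∈𝒞} |B_A| = |B|ᵏ`.  In view of this, the next
result, Theorem 2, can be considered as a special case of Theorem 1"): a finite set `S ⊆ Xⁿ`
dominating a box of its own size, `∏ᵢ λᵢ = |S|`, `∏_{i∈A} λᵢ ≤ |S_A|` (`λ ≥ 0`), satisfies the
uniform cover inequality `|S|ᵏ ≤ ∏_{A∈𝒜} |S_A|` for every uniform `k`-cover `𝒜`.
[cite: BollobasThomason1995, §1 (before Thm 2)] -/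
theorem pow_card_le_prod_card_image_proj_of_box [DecidableEq X] {ι : Type*} [Fintype ι] {n k : ℕ}
    (𝒜 : ι → Finset (Fin n)) (h𝒜 : IsUniformCover k 𝒜) (B : Finset (Fin n → X))
    (lam : Fin n → ℝ) (h0 : ∀ i, 0 ≤ lam i) (hprod : ∏ i, lam i = #B)
    (hbox : ∀ A : Finset (Fin n), ∏ i ∈ A, lam i ≤ #(B.image (proj A))) :
    (#B : ℝ) ^ k ≤ ∏ a, (#(B.image (proj (𝒜 a))) : ℝ) := by
  rw [← hprod, ← prod_prod_eq_prod_pow_of_isUniformCover 𝒜 h𝒜 lam]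
  exact prod_le_prod (fun a _ => prod_nonneg fun i _ => h0 i) fun a _ => hbox (𝒜 a)

/-- Additive form of `prod_prod_eq_prod_pow_of_isUniformCover`: for `σ : [n] → M` in an additive
commutative monoid and a uniform `k`-cover `𝒜`, `∑_a ∑_{i∈𝒜 a} σᵢ = k • ∑ᵢ σᵢ` (the bookkeeping
behind "an additive box gives the uniform-cover inequality of BB Theorem 10").
[cite: BalisterBollobas2012, Thm 10 and Cor 11] -/
theorem sum_sum_eq_smul_sum_of_isUniformCover {M : Type*} [AddCommMonoid M] {ι : Type*}
    [Fintype ι] {n k : ℕ} (𝒜 : ι → Finset (Fin n)) (h𝒜 : IsUniformCover k 𝒜) (σ : Fin n → M) :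
    ∑ a, ∑ i ∈ 𝒜 a, σ i = k • ∑ i, σ i := by
  classical
  rw [smul_sum]
  calc ∑ a, ∑ i ∈ 𝒜 a, σ i = ∑ a, ∑ i, (if i ∈ 𝒜 a then σ i else 0) := by
        refine sum_congr rfl fun a _ => ?_
        rw [sum_ite_mem, univ_inter]
    _ = ∑ i, ∑ a, (if i ∈ 𝒜 a then σ i else 0) := sum_comm
    _ = ∑ i, k • σ i := by
        refine sum_congr rfl fun i _ => ?_
        rw [sum_ite, sum_const_zero, add_zero, sum_const]
        simp only [IsUniformCover] at h𝒜
        rw [h𝒜 i]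

end UniformCover

section BoxTheoremSumsets

open UniformCover
open scoped Pointwise

variable {α : Type*} [AddCommMonoid α] [DecidableEq α]

/-- **Balister–Bollobás 2012, Theorem 8 (first half), non-empty summands.**  "Let `S₁, …, S_n` be
finite sets in a commutative semigroup with sum `S = S₁ + ⋯ + S_n`.  For `A ⊆ [n]` set
`S_A = ∑_{i∈A} S_i` … There are constants `λ₁, …, λ_n ≥ 0` such that `|S| = ∏ λᵢ` and
`|S_A| ≥ ∏_{i∈A} λᵢ` for all `A ⊆ [n]`", here with `λᵢ > 0` for non-empty `S_i` in an additive
commutative monoid (which supplies the empty subsum `S_∅ = {0}`).  Proof as printed ("immediate from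
[the Box Theorem] applied to `S′`"): the representation lemma `exists_repr_card_image_proj_le`
(`|S′| = |S|`, `|(S′)_A| ≤ |S_A|`) and `UniformCover.exists_box_of_nonempty`.
[cite: BalisterBollobas2012, Thm 8] -/
theorem exists_pos_box_card_subsum {n : ℕ} (S : Fin n → Finset α) (hS : ∀ i, (S i).Nonempty) :
    ∃ lam : Fin n → ℝ, (∀ i, 0 < lam i) ∧ ∏ i, lam i = #(∑ i, S i) ∧
      ∀ A : Finset (Fin n), ∏ i ∈ A, lam i ≤ #(∑ i ∈ A, S i) := by
  classical
  obtain ⟨B, hBne, hBcard, hproj⟩ := exists_repr_card_image_proj_le S hS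
  obtain ⟨lam, hpos, hprod, hbox⟩ := exists_box_of_nonempty B hBne
  refine ⟨lam, hpos, by rw [hprod, hBcard], fun A => (hbox A).trans ?_⟩
  exact_mod_cast hproj A

/-- **Balister–Bollobás 2012, Theorem 8 (first half), as printed** (`λᵢ ≥ 0`, arbitrary finite
`S_i`): there are `λ₁, …, λ_n ≥ 0` with `∏ᵢ λᵢ = |S₁ + ⋯ + S_n|` and `∏_{i∈A} λᵢ ≤ |∑_{i∈A} S_i|`
for every `A ⊆ [n]`.  If some `S_j = ∅` then `S = ∅` and `λ ≡ 0` works (`S_∅ = {0}` has one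
element and the empty product is `1`); otherwise `exists_pos_box_card_subsum`.
[cite: BalisterBollobas2012, Thm 8] -/
theorem exists_box_card_subsum {n : ℕ} (S : Fin n → Finset α) :
    ∃ lam : Fin n → ℝ, (∀ i, 0 ≤ lam i) ∧ ∏ i, lam i = #(∑ i, S i) ∧
      ∀ A : Finset (Fin n), ∏ i ∈ A, lam i ≤ #(∑ i ∈ A, S i) := by
  classical
  by_cases hS : ∀ i, (S i).Nonempty
  · obtain ⟨lam, hpos, hprod, hbox⟩ := exists_pos_box_card_subsum S hS
    exact ⟨lam, fun i => (hpos i).le, hprod, hbox⟩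
  · push Not at hS
    obtain ⟨j, hj⟩ := hS
    have hsum : (∑ i, S i) = ∅ := by
      rw [← add_sum_erase univ S (mem_univ j), hj, empty_add]
    refine ⟨fun _ => 0, fun _ => le_rfl, ?_, fun A => ?_⟩
    · rw [hsum, card_empty, Nat.cast_zero]
      exact prod_eq_zero (mem_univ j) rfl
    · rcases A.eq_empty_or_nonempty with rfl | ⟨i, hi⟩
      · simp
      · rw [prod_eq_zero hi rfl]
        exact Nat.cast_nonneg _

end BoxTheoremSumsets

section AdditiveBox

open UniformCover
open scoped Pointwise

/-- Summing a function of the first coordinate over `Σ a, Fin (m a)` counts each `a` with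
multiplicity `m a`. [folklore] -/
private theorem sum_sigma_fin_eq_sum_smul {κ : Type*} [Fintype κ] (m : κ → ℕ) {M : Type*}
    [AddCommMonoid M] (f : κ → M) : ∑ p : (Σ a : κ, Fin (m a)), f p.1 = ∑ a, m a • f a := by
  rw [Fintype.sum_sigma]
  exact Fintype.sum_congr _ _ fun a => by
    change ∑ _y : Fin (m a), f a = _
    rw [sum_const, card_univ, Fintype.card_fin]

/-- Finitely many non-negative rationals have a common denominator: `D > 0` and naturals `m_a`
with `m_a = D y_a`. [folklore] -/
private theorem exists_common_denominator {κ : Type*} [Fintype κ] (y : κ → ℚ)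
    (hy : ∀ a, 0 ≤ y a) : ∃ D : ℕ, 0 < D ∧ ∃ m : κ → ℕ, ∀ a, (m a : ℚ) = D * y a := by
  classical
  refine ⟨∏ a, (y a).den, prod_pos fun a _ => (y a).den_pos, ?_⟩
  have key : ∀ a, ∃ m : ℕ, (m : ℚ) = ((∏ b, (y b).den : ℕ) : ℚ) * y a := by
    intro a
    obtain ⟨c, hc⟩ : (y a).den ∣ ∏ b, (y b).den :=
      dvd_prod_of_mem (fun b => (y b).den) (mem_univ a)
    have hnum : 0 ≤ (y a).num := Rat.num_nonneg.2 (hy a)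
    refine ⟨c * (y a).num.toNat, ?_⟩
    have h1 : (((y a).num.toNat : ℕ) : ℚ) = ((y a).num : ℚ) := by
      exact_mod_cast Int.toNat_of_nonneg hnum
    have h2 := Rat.mul_den_eq_num (y a)
    rw [hc]
    push_cast
    rw [h1]
    linear_combination (-(c : ℚ)) * h2
  choose m hm using key
  exact ⟨m, hm⟩

variable {G : Type*} [AddCommGroup G] [DecidableEq G]

/-- A subsum of non-empty finsets is non-empty. [folklore] -/
private theorem subsum_nonempty {n : ℕ} (S : Fin n → Finset G) (hS : ∀ i, (S i).Nonempty)
    (A : Finset (Fin n)) : (∑ i ∈ A, S i).Nonempty :=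
  Finset.sum_induction _ (fun T : Finset G => T.Nonempty) (fun _ _ ha hb => ha.add hb)
    Finset.zero_nonempty (fun i _ => hS i)

/-- **Balister–Bollobás 2012, Corollary 11 — the additive Box Theorem in torsion-free groups.**
"If the sets `S_i` lie in a torsion-free abelian group then there exists constants `σᵢ` such that
`|S| − 1 = ∑_{i=1}^n σᵢ` and `|S_A| − 1 ≤ ∑_{i∈A} σᵢ` for all `A ⊆ [n]`" — for non-empty finite
`S₁, …, S_n`, with RATIONAL `σᵢ` (all data are integers).  No proof is printed; here: Farkas' lemma
`Literature.Combinatorics.Optimization.farkas_eq` over `ℚ` for `−∑_{i∈A} σ_i ≤ 1 − |S_A|`,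
`∑_i σ_i = |S| − 1`; a rational certificate `y_A ≥ 0` (with `∑_{A∋i} y_A = μ` for every `i`) is
cleared of denominators into an honest uniform `k`-cover with `m_A = D y_A` copies of `A`,
`k = D μ`, to which BB Theorem 10 (`exists_pair_subsets_sum_card_subsum_le`) applies:
`∑_A m_A (|S_A| − 1) ≤ k(|S| − 1)`, contradicting the strict certificate inequality.
[cite: BalisterBollobas2012, Cor 11] -/
theorem exists_additive_box_card_subsum [IsAddTorsionFree G] {n : ℕ} (S : Fin n → Finset G)
    (hS : ∀ i, (S i).Nonempty) :
    ∃ σ : Fin n → ℚ, ∑ i, σ i = (#(∑ i, S i) : ℚ) - 1 ∧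
      ∀ A : Finset (Fin n), (#(∑ i ∈ A, S i) : ℚ) - 1 ≤ ∑ i ∈ A, σ i := by
  classical
  -- data: `N_A = |S_A| ≥ 1`, `|S| ≥ 1`
  set N : Finset (Fin n) → ℕ := fun A => #(∑ i ∈ A, S i) with hN
  have hN1 : ∀ A, 1 ≤ N A := fun A => card_pos.2 (subsum_nonempty S hS A)
  have hS1 : 1 ≤ #(∑ i, S i) := card_pos.2 (subsum_nonempty S hS univ)
  -- Farkas' lemma over `ℚ` for `-∑_{j∈A} σ_j ≤ 1 - N_A (A ⊆ [n])`, `∑_j σ_j = |S| - 1`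
  rcases Literature.Combinatorics.Optimization.farkas_eq (𝕜 := ℚ) (p := Unit)
      (fun (A : Finset (Fin n)) (j : Fin n) => if j ∈ A then (-1 : ℚ) else 0)
      (fun A => 1 - (N A : ℚ)) (fun _ _ => (1 : ℚ)) (fun _ => (#(∑ i, S i) : ℚ) - 1) with
    ⟨σ, hle, heq⟩ | ⟨y, z, hy, hyA, hyb⟩
  · refine ⟨σ, by simpa using heq (), fun A => ?_⟩
    have h := hle A
    simp only [ite_mul, neg_one_mul, zero_mul] at h
    rw [← sum_filter, sum_neg_distrib] at h
    have hfilter : univ.filter (fun j => j ∈ A) = A := by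
      ext j; simp
    rw [hfilter] at h
    change -(∑ j ∈ A, σ j) ≤ 1 - (N A : ℚ) at h
    linarith
  · exfalso
    -- the certificate: `z = ∑_{A∋j} y_A` for every `j`, and `∑_A y_A (1 - N_A) + z (|S| - 1) < 0`
    have hcov : ∀ j : Fin n, ∑ A ∈ univ.filter (fun A => j ∈ A), y A = z () := by
      intro j
      have h := hyA j
      simp only [mul_ite, mul_neg, mul_one, mul_zero, Fintype.sum_unique] at h
      rw [← sum_filter, sum_neg_distrib] at h
      linarith
    have hlt : ∑ A, y A * (1 - (N A : ℚ)) + z () * ((#(∑ i, S i) : ℚ) - 1) < 0 := by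
      simpa [Fintype.sum_unique] using hyb
    -- it suffices to show the (fractional) uniform-cover superadditivity inequality
    suffices hmain : ∑ A, y A * ((N A : ℚ) - 1) ≤ z () * ((#(∑ i, S i) : ℚ) - 1) by
      have : ∑ A, y A * (1 - (N A : ℚ)) = -∑ A, y A * ((N A : ℚ) - 1) := by
        rw [← sum_neg_distrib]
        exact sum_congr rfl fun A _ => by ring
      rw [this] at hlt
      linarith
    rcases Nat.eq_zero_or_pos n with hn | hn
    · -- `n = 0`: both sides vanish (`S = S_∅ = {0}`)
      subst hn
      have hA : ∀ A : Finset (Fin 0), (N A : ℚ) - 1 = 0 := fun A => by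
        rw [Finset.eq_empty_of_isEmpty A, hN]
        simp
      have hS0 : (#(∑ i : Fin 0, S i) : ℚ) - 1 = 0 := by simp
      rw [hS0, mul_zero]
      exact le_of_eq (sum_eq_zero fun A _ => by rw [hA A, mul_zero])
    · -- `n ≥ 1`: clear denominators and apply Theorem 10 to an honest uniform cover
      obtain ⟨j₀⟩ : Nonempty (Fin n) := ⟨⟨0, hn⟩⟩
      set μ : ℚ := z () with hμ
      have hμ0 : 0 ≤ μ := by
        rw [← hcov j₀]
        exact sum_nonneg fun A _ => hy A
      obtain ⟨D, hD, m, hm⟩ := exists_common_denominator y hy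
      -- the integer cover multiplicity `k = D μ`
      set k : ℕ := ∑ A ∈ univ.filter (fun A => j₀ ∈ A), m A with hk
      have hkμ : (k : ℚ) = D * μ := by
        rw [hk, ← hcov j₀, mul_sum]
        push_cast
        exact sum_congr rfl fun A _ => hm A
      have hkj : ∀ j : Fin n, ∑ A ∈ univ.filter (fun A => j ∈ A), m A = k := by
        intro j
        have : ((∑ A ∈ univ.filter (fun A => j ∈ A), m A : ℕ) : ℚ) = (k : ℚ) := by
          rw [hkμ, ← hcov j, mul_sum]
          push_cast
          exact sum_congr rfl fun A _ => hm A
        exact_mod_cast this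
      -- the multiset with `m_A` copies of `A`, as an indexed family
      let ι := Σ A : Finset (Fin n), Fin (m A)
      let 𝒜 : ι → Finset (Fin n) := fun p => p.1
      have hunif : IsUniformCover k 𝒜 := by
        intro j
        rw [← hkj j, card_filter]
        change ∑ p : ι, (if j ∈ p.1 then 1 else 0) = _
        rw [sum_sigma_fin_eq_sum_smul m (fun A => if j ∈ A then 1 else 0)]
        simp only [smul_eq_mul, mul_ite, mul_one, mul_zero]
        rw [← sum_filter]
      -- Theorem 10 (torsion-free form) for this cover
      obtain ⟨E, -, hE⟩ := exists_pair_subsets_sum_card_subsum_le S hS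
      obtain ⟨hsub, hle⟩ := hE ι k 𝒜 hunif
      have hle' : ∑ p : ι, N (𝒜 p) ≤ k * (#(∑ i, S i) - 1) + Fintype.card ι :=
        hle.trans (Nat.add_le_add_right (Nat.mul_le_mul_left _
          (Nat.sub_le_sub_right (card_le_card hsub) _)) _)
      have hsumι : ∑ p : ι, N (𝒜 p) = ∑ A, m A * N A := by
        change ∑ p : ι, N p.1 = _
        rw [sum_sigma_fin_eq_sum_smul m N]
        simp only [smul_eq_mul]
      have hcardι : Fintype.card ι = ∑ A, m A := by
        simp only [ι, Fintype.card_sigma, Fintype.card_fin]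
      rw [hsumι, hcardι] at hle'
      -- cast to `ℚ` and divide by `D`
      have hQ : (∑ A, (m A : ℚ) * (N A : ℚ)) ≤ (k : ℚ) * ((#(∑ i, S i) : ℚ) - 1) + ∑ A, (m A : ℚ) := by
        have := (Nat.cast_le (α := ℚ)).2 hle'
        push_cast [Nat.cast_sub hS1] at this
        exact this
      have hD0 : (0 : ℚ) < D := by exact_mod_cast hD
      have key : (D : ℚ) * ∑ A, y A * ((N A : ℚ) - 1) ≤ (D : ℚ) * (μ * ((#(∑ i, S i) : ℚ) - 1)) := by
        have e1 : (D : ℚ) * ∑ A, y A * ((N A : ℚ) - 1) =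
            ∑ A, (m A : ℚ) * (N A : ℚ) - ∑ A, (m A : ℚ) := by
          rw [mul_sum, ← sum_sub_distrib]
          exact sum_congr rfl fun A _ => by rw [hm A]; ring
        have e2 : (D : ℚ) * (μ * ((#(∑ i, S i) : ℚ) - 1)) = (k : ℚ) * ((#(∑ i, S i) : ℚ) - 1) := by
          rw [hkμ]; ring
        rw [e1, e2]
        linarith
      exact le_of_mul_le_mul_left key hD0

/-- Corollary 11 with the (automatic) sign information: the additive box constants satisfy
`σᵢ ≥ |S_i| − 1 ≥ 0` (the constraint at `A = {i}`). [cite: BalisterBollobas2012, Cor 11] -/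
theorem exists_additive_box_card_subsum_nonneg [IsAddTorsionFree G] {n : ℕ} (S : Fin n → Finset G)
    (hS : ∀ i, (S i).Nonempty) :
    ∃ σ : Fin n → ℚ, (∀ i, (#(S i) : ℚ) - 1 ≤ σ i) ∧ (∀ i, 0 ≤ σ i) ∧
      ∑ i, σ i = (#(∑ i, S i) : ℚ) - 1 ∧
      ∀ A : Finset (Fin n), (#(∑ i ∈ A, S i) : ℚ) - 1 ≤ ∑ i ∈ A, σ i := by
  obtain ⟨σ, hsum, hbox⟩ := exists_additive_box_card_subsum S hS
  have hsingle : ∀ i, (#(S i) : ℚ) - 1 ≤ σ i := fun i => by simpa using hbox {i}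
  refine ⟨σ, hsingle, fun i => (sub_nonneg.2 ?_).trans (hsingle i), hsum, hbox⟩
  exact_mod_cast (hS i).card_pos

/-- Corollary 11 with real constants (the rational ones, cast). [cite: BalisterBollobas2012, Cor 11] -/
theorem exists_additive_box_card_subsum_real [IsAddTorsionFree G] {n : ℕ} (S : Fin n → Finset G)
    (hS : ∀ i, (S i).Nonempty) :
    ∃ σ : Fin n → ℝ, (∀ i, 0 ≤ σ i) ∧ ∑ i, σ i = (#(∑ i, S i) : ℝ) - 1 ∧
      ∀ A : Finset (Fin n), (#(∑ i ∈ A, S i) : ℝ) - 1 ≤ ∑ i ∈ A, σ i := by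
  obtain ⟨σ, -, h0, hsum, hbox⟩ := exists_additive_box_card_subsum_nonneg S hS
  refine ⟨fun i => (σ i : ℝ), fun i => by simpa using (Rat.cast_le (K := ℝ)).2 (h0 i), ?_, fun A => ?_⟩
  · have := congrArg (fun q : ℚ => (q : ℝ)) hsum
    simpa using this
  · have := (Rat.cast_le (K := ℝ)).2 (hbox A)
    simpa using this

/-- **An additive box gives back the first inequality of BB Theorem 10**: if `∑ᵢ σᵢ = |S| − 1` and
`|S_A| − 1 ≤ ∑_{i∈A} σᵢ` for all `A`, then `∑_{A∈𝒜} (|S_A| − 1) ≤ k (|S| − 1)` for every uniform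
`k`-cover `𝒜` (so Corollary 11 and Theorem 10's first inequality are equivalent by LP duality).
[cite: BalisterBollobas2012, Thm 10 and Cor 11] -/
theorem sum_card_subsum_le_of_additive_box {ι : Type*} [Fintype ι] {n k : ℕ}
    (𝒜 : ι → Finset (Fin n)) (h𝒜 : IsUniformCover k 𝒜) (S : Fin n → Finset G) (σ : Fin n → ℚ)
    (hsum : ∑ i, σ i = (#(∑ i, S i) : ℚ) - 1)
    (hbox : ∀ A : Finset (Fin n), (#(∑ i ∈ A, S i) : ℚ) - 1 ≤ ∑ i ∈ A, σ i) :
    ∑ a, ((#(∑ i ∈ 𝒜 a, S i) : ℚ) - 1) ≤ k * ((#(∑ i, S i) : ℚ) - 1) := by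
  calc ∑ a, ((#(∑ i ∈ 𝒜 a, S i) : ℚ) - 1) ≤ ∑ a, ∑ i ∈ 𝒜 a, σ i := sum_le_sum fun a _ => hbox _
    _ = k • ∑ i, σ i := sum_sum_eq_smul_sum_of_isUniformCover 𝒜 h𝒜 σ
    _ = k * ((#(∑ i, S i) : ℚ) - 1) := by rw [hsum, nsmul_eq_mul]

end AdditiveBox

end Literature.Combinatorics.Additive
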